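import Mathlib
import Summits.NavierStokesRegularity.NavierStokesRegularity.Theorems.FilamentSkeletonRssSkeletonJ1RFrameDefs
import Summits.NavierStokesRegularity.NavierStokesRegularity.Theorems.FilamentSkeletonRssSkeletonJ1RSlicedModelCalculus
import Summits.NavierStokesRegularity.NavierStokesRegularity.Theorems.FilamentSkeletonRssSkeletonJ1RFarTransport
import Summits.NavierStokesRegularity.NavierStokesRegularity.Theorems.FilamentSkeletonRssMatchedKernelTangencyProjection
import Summits.NavierStokesRegularity.NavierStokesRegularity.Theorems.FilamentSkeletonRssClause13LinearisedMap
import Summits.NavierStokesRegularity.NavierStokesRegularity.Theorems.FilamentSkeletonRssClause13TraceIdentity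
import Summits.NavierStokesRegularity.NavierStokesRegularity.Theorems.FilamentSkeletonRssSkeletonJ1RSlicedModel
import Summits.NavierStokesRegularity.NavierStokesRegularity.Theorems.FilamentSkeletonRssNormalVariationRigidity

/-!
# Crux `SkeletonJ1R` (stmt-NavierStokesRegularity-23610) · line `streamline_kantorovich_R` · stub L (`ReferenceInjectivityL`) —
# THE MODEL-REGION ("FAR") PART OF REFERENCE INJECTIVITY: outside the switched ball the linearised switched normal defect is the
# explicit first-order transport operator `Y ↦ −λY − (7/4)τ·Y′_⊥ (+ O(|τ|‖x″‖)·Y)`, and a normal variation is pinned there, with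
# GAIN 2, by its value at the collar exit and the size of its linearised defect.

Lead `ns-fsr-lead-23610` g0, 2026-08-29 (the lead's own stub L, first brick; `--supports` the crux).  MODEL rung, NEGATIVE side of the
ladder: statements about a HYPOTHETICAL filament-type blow-up skeleton; nothing here bears on Navier–Stokes regularity.

With `ℓ = Rb√(Γ log Γ)`, at a parameter `τ` where the reference point is in the pure model region `2ℓ² < ‖x_j τ‖²` (switch weight `0`
on a neighbourhood), for a `C¹` variation `Y` and a model `M` differentiable at `x_j τ` and tangent there (`M(x_j τ) = w·x_j′ τ`):
* `swDefect_eventuallyEq_model` — for `s` near `0` the switched defect of `x + sY` at `(j, τ)` is the tangency defect of `M` alone;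
* `swDefect_model_hasDerivAt` — its `s`-derivative at `0` is `DM·Y − ⟪DM·Y, x′⟫x′ + (w⟪x′, Y′⟫)x′ − w·Y′`
  (`MatchedKernel.hasDerivAt_tangencyDefect_unit`);
* `SlicedModel.fderiv_apply_of_inner_ne_zero` — for the datum-SLICED model, `DM(x_j τ)V = −λ(V − c·x′) + c·((7/4)x′ + (7/4)τ·x″)` with
  `c = ⟪V, t_j⟫/⟪x′, t_j⟫` (slice + tangent derivatives, `…SlicedModelCalculus`);
* `far_transport_ineq` — hence for a NORMAL variation (`Y ⊥ x′`) with derivative `D` of the switched defect: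
  `‖(7/4)τ·Y′ + λY‖ ≤ ‖D‖ + (7/2)·(|τ|‖x″ τ‖)·‖Y τ‖` (tilt `‖x′ − t_j‖ ≤ 1/2`);
* `far_pinning_pos` / `far_pinning_neg` — on a parameter interval `[τ₀, T]` (`0 < τ₀`) resp. `[T, τ₀]` (`τ₀ < 0`) lying in the model region,
  with `|τ|‖x″‖ ≤ λ/7` there and `‖D‖ ≤ L` pointwise: `‖Y τ‖ ≤ 2‖Y τ₀‖ + 2L/λ` (axial transport estimate `norm_le_of_axial_transport` + a
  maximum argument; the value at the collar exit `τ₀` is NOT pinned here — that is the core part of stub L).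
-/

set_option linter.dupNamespace false -- `NavierStokesRegularity.NavierStokesRegularity` path/namespace repetition is the tree convention
set_option linter.style.longLine false -- statement lines follow the registered skeleton's layout

namespace Summit.NavierStokesRegularity.NavierStokesRegularity.Theorems.SkeletonJ1RFrame

open Set Function Filter Real Topology
open scoped InnerProductSpace
open Summit.NavierStokesRegularity.NavierStokesRegularity.Theorems.MatchedKernel (deriv_add_smul_curve hasDerivAt_tangencyDefect_unit
  inner_deriv_deriv_deriv_eq_zero)
open Summit.NavierStokesRegularity.NavierStokesRegularity.Theorems.NormalVariationRigidity (inner_iteratedDeriv_two_eq_neg iteratedDeriv_two_eq)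

variable {N : ℕ} {Γ Rb ρ lam α : ℝ} {γ : Fin N → ℝ} {t : Fin N → EuclideanSpace ℝ (Fin 3)}
  {x Y : Fin N → ℝ → EuclideanSpace ℝ (Fin 3)} {M : EuclideanSpace ℝ (Fin 3) → EuclideanSpace ℝ (Fin 3)}

/-! ## §1 In the model region the switched defect is the tangency defect of the model -/

/-- In the pure model region `2ℓ² < ‖x_j τ‖²` (`ℓ = Rb√(Γ log Γ) ≠ 0`), for `s` near `0` the switched normal defect of `x + sY` at `(j, τ)` is
`M(P s) − (⟪M(P s), Q s⟫/‖Q s‖²)•Q s` with `P s = x_j τ + s•Y_j τ`, `Q s = x_j′ τ + s•Y_j′ τ`. [folklore] -/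
theorem swDefect_eventuallyEq_model (hℓ : Rb * Real.sqrt (Γ * Real.log Γ) ≠ 0) (j : Fin N) (τ : ℝ) (hxj : ContDiff ℝ 1 (x j))
    (hYj : ContDiff ℝ 1 (Y j)) (hfar : 2 * (Rb * Real.sqrt (Γ * Real.log Γ)) ^ 2 < ‖x j τ‖ ^ 2) :
    (fun s : ℝ => swDefect Γ Rb γ α M (fun k σ => x k σ + s • Y k σ) j τ) =ᶠ[𝓝 0] fun s : ℝ =>
      M (x j τ + s • Y j τ) -
        (⟪M (x j τ + s • Y j τ), deriv (x j) τ + s • deriv (Y j) τ⟫_ℝ / ‖deriv (x j) τ + s • deriv (Y j) τ‖ ^ 2) •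
          (deriv (x j) τ + s • deriv (Y j) τ) := by
  have hcont : ContinuousAt (fun s : ℝ => ‖x j τ + s • Y j τ‖ ^ 2) 0 := by fun_prop
  have h0 : 2 * (Rb * Real.sqrt (Γ * Real.log Γ)) ^ 2 < ‖x j τ + (0:ℝ) • Y j τ‖ ^ 2 := by simpa using hfar
  have hev : ∀ᶠ s in 𝓝 (0:ℝ), 2 * (Rb * Real.sqrt (Γ * Real.log Γ)) ^ 2 < ‖x j τ + s • Y j τ‖ ^ 2 :=
    hcont.eventually (lt_mem_nhds h0)
  filter_upwards [hev] with s hs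
  have hw : switchWeight (Rb * Real.sqrt (Γ * Real.log Γ)) 1 (x j τ + s • Y j τ) = 0 :=
    switchWeight_eq_zero_of_le_sq hℓ (by rw [mul_one]; exact hs.le)
  have hd : deriv (fun σ => x j σ + s • Y j σ) τ = deriv (x j) τ + s • deriv (Y j) τ := deriv_add_smul_curve hxj hYj s τ
  unfold swDefect switchedField
  simp only [hw, hd, zero_smul, zero_add, sub_zero, one_smul]

/-- **First variation of the switched defect in the model region.**  With `M` differentiable at `x_j τ`, `‖x_j′ τ‖ = 1` and `M(x_j τ) = w•x_j′ τ`: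
`d/ds|₀ swDefect(x + sY)(j, τ) = DM·Y − ⟪DM·Y, x′⟫x′ + (w⟪x′, Y′⟫)x′ − w·Y′` (`DM·Y = fderiv M (x_j τ) (Y_j τ)`). [folklore] -/
theorem swDefect_model_hasDerivAt (hℓ : Rb * Real.sqrt (Γ * Real.log Γ) ≠ 0) (j : Fin N) (τ : ℝ) (hxj : ContDiff ℝ 1 (x j))
    (hYj : ContDiff ℝ 1 (Y j)) (hMd : DifferentiableAt ℝ M (x j τ)) (hunit : ‖deriv (x j) τ‖ = 1) {w : ℝ}
    (hMw : M (x j τ) = w • deriv (x j) τ) (hfar : 2 * (Rb * Real.sqrt (Γ * Real.log Γ)) ^ 2 < ‖x j τ‖ ^ 2) :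
    HasDerivAt (fun s : ℝ => swDefect Γ Rb γ α M (fun k σ => x k σ + s • Y k σ) j τ)
      (fderiv ℝ M (x j τ) (Y j τ) - ⟪fderiv ℝ M (x j τ) (Y j τ), deriv (x j) τ⟫_ℝ • deriv (x j) τ
        + (w * ⟪deriv (x j) τ, deriv (Y j) τ⟫_ℝ) • deriv (x j) τ - w • deriv (Y j) τ) 0 := by
  have hW : HasDerivAt (fun s : ℝ => M (x j τ + s • Y j τ)) (fderiv ℝ M (x j τ) (Y j τ)) 0 := by
    have hp : HasDerivAt (fun s : ℝ => x j τ + s • Y j τ) (Y j τ) 0 := by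
      simpa using ((hasDerivAt_id' (x := (0:ℝ))).smul_const (Y j τ)).const_add (x j τ)
    exact hMd.hasFDerivAt.comp_hasDerivAt_of_eq (0:ℝ) hp (by simp)
  have hP : HasDerivAt (fun s : ℝ => deriv (x j) τ + s • deriv (Y j) τ) (deriv (Y j) τ) 0 := by
    simpa using ((hasDerivAt_id' (x := (0:ℝ))).smul_const (deriv (Y j) τ)).const_add (deriv (x j) τ)
  have h := hasDerivAt_tangencyDefect_unit (W := fun s : ℝ => M (x j τ + s • Y j τ))
    (P := fun s : ℝ => deriv (x j) τ + s • deriv (Y j) τ) (w := w) hW hP (by simpa using hunit) (by simpa using hMw)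
  refine (h.congr_of_eventuallyEq (swDefect_eventuallyEq_model hℓ j τ hxj hYj hfar)).congr_deriv ?_
  simp only [zero_smul, add_zero]

/-! ## §2 The derivative of the datum-sliced model on a general vector -/

/-- For the datum-SLICED model (`0 < ρ√Γ`, `x_j ∈ C²`) and `⟪x_j′ τ, t_j⟫ ≠ 0`: every `V` splits as `(V − c•x′) + c•x′` with `V − c•x′ ⊥ t_j`,
`c = ⟪V, t_j⟫/⟪x′, t_j⟫`, so `DM(x_j τ)V = −λ(V − c•x′) + c•((7/4)x′ + (7/4)τ•x″)`. [folklore] -/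
theorem SlicedModel.fderiv_apply_of_inner_ne_zero (hM : SlicedModel Γ ρ lam t x M) (hρΓ : 0 < ρ * Real.sqrt Γ) (j : Fin N)
    (hxj : ContDiff ℝ 2 (x j)) (τ : ℝ) (hPt : ⟪deriv (x j) τ, t j⟫_ℝ ≠ 0) (V : EuclideanSpace ℝ (Fin 3)) :
    fderiv ℝ M (x j τ) V =
      -(lam • (V - (⟪V, t j⟫_ℝ / ⟪deriv (x j) τ, t j⟫_ℝ) • deriv (x j) τ)) +
        (⟪V, t j⟫_ℝ / ⟪deriv (x j) τ, t j⟫_ℝ) • ((7/4:ℝ) • deriv (x j) τ + ((7/4:ℝ) * τ) • iteratedDeriv 2 (x j) τ) := by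
  set c : ℝ := ⟪V, t j⟫_ℝ / ⟪deriv (x j) τ, t j⟫_ℝ with hc
  have hz : ⟪V - c • deriv (x j) τ, t j⟫_ℝ = 0 := by
    rw [inner_sub_left, real_inner_smul_left, hc, div_mul_cancel₀ _ hPt, sub_self]
  have hsplit : V = (V - c • deriv (x j) τ) + c • deriv (x j) τ := by abel
  conv_lhs => rw [hsplit]
  rw [map_add, map_smul, hM.fderiv_apply_slice hρΓ j τ _ hz, hM.fderiv_apply_tangent hρΓ.le j hxj τ]

/-! ## §3 The pointwise transport inequality in the model region -/

/-- Geometry of the split coefficient: `Y ⊥ x′`, `‖x′‖ = ‖t‖ = 1`, `‖x′ − t‖ ≤ 1/2` ⇒ `|⟪Y, t⟫/⟪x′, t⟫| ≤ ‖Y‖` (indeed `≤ (4/7)‖Y‖`). [folklore] -/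
theorem abs_splitCoeff_le {P T V : EuclideanSpace ℝ (Fin 3)} (hP : ‖P‖ = 1) (hT : ‖T‖ = 1) (htilt : ‖P - T‖ ≤ 1 / 2)
    (hVP : ⟪V, P⟫_ℝ = 0) : |⟪V, T⟫_ℝ / ⟪P, T⟫_ℝ| ≤ ‖V‖ := by
  have hPT : ⟪P, T⟫_ℝ = 1 - ‖P - T‖ ^ 2 / 2 := inner_eq_one_sub_half_norm_sub_sq P T hP hT
  have hPT' : 7 / 8 ≤ ⟪P, T⟫_ℝ := by rw [hPT]; nlinarith [norm_nonneg (P - T)]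
  have hVT : ⟪V, T⟫_ℝ = ⟪V, T - P⟫_ℝ := by rw [inner_sub_right, hVP, sub_zero]
  have hVT' : |⟪V, T⟫_ℝ| ≤ ‖V‖ * (1 / 2) := by
    rw [hVT]
    refine (abs_real_inner_le_norm _ _).trans (mul_le_mul_of_nonneg_left ?_ (norm_nonneg _))
    rwa [norm_sub_rev]
  rw [abs_div, abs_of_pos (by linarith : 0 < ⟪P, T⟫_ℝ), div_le_iff₀ (by linarith)]
  nlinarith [norm_nonneg V]

/-- **Pointwise transport inequality in the model region.**  Datum-sliced model (`0 < ρ√Γ`), `C²` unit-speed reference with tilt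
`‖x_j′ τ − t_j‖ ≤ 1/2` (`‖t_j‖ = 1`), `C¹` NORMAL variation `Y` (`Y_j ⊥ x_j′` everywhere), `2ℓ² < ‖x_j τ‖²` (`ℓ ≠ 0`); if `D` is the
`s`-derivative at `0` of the switched defect of `x + sY` at `(j, τ)`, then
`‖(7/4)τ•Y_j′ τ + λ•Y_j τ‖ ≤ ‖D‖ + (7/2)(|τ|‖x_j″ τ‖)‖Y_j τ‖`. [folklore] -/
theorem far_transport_ineq (hM : SlicedModel Γ ρ lam t x M) (hρΓ : 0 < ρ * Real.sqrt Γ) (hℓ : Rb * Real.sqrt (Γ * Real.log Γ) ≠ 0)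
    (j : Fin N) (hxj : ContDiff ℝ 2 (x j)) (hunit : ∀ s, ‖deriv (x j) s‖ = 1) (ht : ‖t j‖ = 1) (hYj : ContDiff ℝ 1 (Y j))
    (hperp : ∀ s, ⟪Y j s, deriv (x j) s⟫_ℝ = 0) (τ : ℝ) (htilt : ‖deriv (x j) τ - t j‖ ≤ 1 / 2)
    (hfar : 2 * (Rb * Real.sqrt (Γ * Real.log Γ)) ^ 2 < ‖x j τ‖ ^ 2) {D : EuclideanSpace ℝ (Fin 3)}
    (hD : HasDerivAt (fun s : ℝ => swDefect Γ Rb γ α M (fun k σ => x k σ + s • Y k σ) j τ) D 0) :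
    ‖((7/4:ℝ) * τ) • deriv (Y j) τ + lam • Y j τ‖ ≤ ‖D‖ + (7/2:ℝ) * (|τ| * ‖iteratedDeriv 2 (x j) τ‖) * ‖Y j τ‖ := by
  -- names
  set P := deriv (x j) τ with hPdef
  set V := Y j τ with hVdef
  set P' := deriv (Y j) τ with hP'def
  set K := iteratedDeriv 2 (x j) τ with hKdef
  set w : ℝ := (7/4:ℝ) * τ with hw
  set c : ℝ := ⟪V, t j⟫_ℝ / ⟪P, t j⟫_ℝ with hc
  have hP1 : ‖P‖ = 1 := hunit τ
  have hPP : ⟪P, P⟫_ℝ = 1 := by rw [real_inner_self_eq_norm_sq, hP1, one_pow]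
  have hVP : ⟪V, P⟫_ℝ = 0 := hperp τ
  have hKP : ⟪K, P⟫_ℝ = 0 := by
    rw [hKdef, iteratedDeriv_two_eq]; exact inner_deriv_deriv_deriv_eq_zero hxj hunit τ
  have hPt : ⟪P, t j⟫_ℝ ≠ 0 := by
    have : ⟪P, t j⟫_ℝ = 1 - ‖P - t j‖ ^ 2 / 2 := inner_eq_one_sub_half_norm_sub_sq P (t j) hP1 ht
    rw [this]; nlinarith [norm_nonneg (P - t j)]
  -- the derivative, identified
  have hMw : M (x j τ) = w • P := hM.apply_ref hρΓ.le j τ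
  have hMd : DifferentiableAt ℝ M (x j τ) := (hM.1.differentiable (by norm_num)).differentiableAt
  have hD' := swDefect_model_hasDerivAt (γ := γ) (α := α) hℓ j τ (hxj.of_le (by norm_num)) hYj hMd hP1 hMw hfar
  have hDeq : D = fderiv ℝ M (x j τ) V - ⟪fderiv ℝ M (x j τ) V, P⟫_ℝ • P + (w * ⟪P, P'⟫_ℝ) • P - w • P' := hD.unique hD'
  have hW' : fderiv ℝ M (x j τ) V = -(lam • (V - c • P)) + c • ((7/4:ℝ) • P + w • K) :=
    hM.fderiv_apply_of_inner_ne_zero hρΓ j hxj τ hPt V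
  have hW'P : ⟪fderiv ℝ M (x j τ) V, P⟫_ℝ = lam * c + (7/4:ℝ) * c := by
    rw [hW', inner_add_left, inner_neg_left, real_inner_smul_left, inner_sub_left, real_inner_smul_left, real_inner_smul_left,
      inner_add_left, real_inner_smul_left, real_inner_smul_left, hVP, hPP, hKP]
    ring
  -- the transport identity `w•Y′ + λ•Y = −D + (c w)•x″ + (w⟪x′,Y′⟫)•x′`
  have hid : w • P' + lam • V = -D + (c * w) • K + (w * ⟪P, P'⟫_ℝ) • P := by
    rw [hDeq, hW'P, hW']
    module
  -- sizes of the junk terms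
  have hPP' : |⟪P, P'⟫_ℝ| ≤ ‖V‖ * ‖K‖ := by
    have h1 : ⟪V, K⟫_ℝ = -⟪P', P⟫_ℝ := by
      rw [hVdef, hKdef, hP'def, hPdef]; exact inner_iteratedDeriv_two_eq_neg hxj hYj (hperp) τ
    rw [real_inner_comm, show ⟪P', P⟫_ℝ = -⟪V, K⟫_ℝ by rw [h1]; ring, abs_neg]
    exact abs_real_inner_le_norm _ _
  have hcV : |c| ≤ ‖V‖ := abs_splitCoeff_le hP1 ht htilt hVP
  have hw_abs : |w| = (7/4:ℝ) * |τ| := by rw [hw, abs_mul, abs_of_pos (by norm_num : (0:ℝ) < 7/4)]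
  calc ‖w • P' + lam • V‖ = ‖-D + (c * w) • K + (w * ⟪P, P'⟫_ℝ) • P‖ := by rw [hid]
    _ ≤ ‖-D‖ + ‖(c * w) • K‖ + ‖(w * ⟪P, P'⟫_ℝ) • P‖ := norm_add₃_le
    _ = ‖D‖ + |c| * |w| * ‖K‖ + |w| * |⟪P, P'⟫_ℝ| := by
        simp only [norm_neg, norm_smul, hP1, mul_one, Real.norm_eq_abs, abs_mul, hw]
    _ ≤ ‖D‖ + ‖V‖ * |w| * ‖K‖ + |w| * (‖V‖ * ‖K‖) := by
        gcongr
    _ = ‖D‖ + (7/2:ℝ) * (|τ| * ‖K‖) * ‖V‖ := by rw [hw_abs]; ring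

/-! ## §4 Far pinning: gain 2 from the collar exit -/

/-- **Far pinning, forward arm.**  Datum-sliced model with `0 < λ`, `0 < ρ√Γ`, `ℓ ≠ 0`; `C²` unit-speed reference with tilt `≤ 1/2`; `C¹` normal
variation `Y`.  On a parameter interval `[τ₀, T]`, `0 < τ₀`, lying in the model region (`2ℓ² < ‖x_j s‖²`) on which `|s|‖x_j″ s‖ ≤ λ/7` and the
switched defect of `x + sY` has an `s`-derivative of norm `≤ L` at every point: `‖Y_j τ‖ ≤ 2‖Y_j τ₀‖ + 2L/λ` on `[τ₀, T]`. [folklore] -/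
theorem far_pinning_pos (hM : SlicedModel Γ ρ lam t x M) (hlam : 0 < lam) (hρΓ : 0 < ρ * Real.sqrt Γ)
    (hℓ : Rb * Real.sqrt (Γ * Real.log Γ) ≠ 0) (j : Fin N) (hxj : ContDiff ℝ 2 (x j)) (hunit : ∀ s, ‖deriv (x j) s‖ = 1) (ht : ‖t j‖ = 1)
    (htilt : ∀ s, ‖deriv (x j) s - t j‖ ≤ 1 / 2) (hYj : ContDiff ℝ 1 (Y j)) (hperp : ∀ s, ⟪Y j s, deriv (x j) s⟫_ℝ = 0)
    {τ₀ T L : ℝ} (hτ₀ : 0 < τ₀) (hT : τ₀ ≤ T)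
    (hfar : ∀ s ∈ Icc τ₀ T, 2 * (Rb * Real.sqrt (Γ * Real.log Γ)) ^ 2 < ‖x j s‖ ^ 2)
    (hκ : ∀ s ∈ Icc τ₀ T, |s| * ‖iteratedDeriv 2 (x j) s‖ ≤ lam / 7)
    (hD : ∀ s ∈ Icc τ₀ T, ∃ D : EuclideanSpace ℝ (Fin 3),
      HasDerivAt (fun r : ℝ => swDefect Γ Rb γ α M (fun k σ => x k σ + r • Y k σ) j s) D 0 ∧ ‖D‖ ≤ L) :
    ∀ τ ∈ Icc τ₀ T, ‖Y j τ‖ ≤ 2 * ‖Y j τ₀‖ + 2 * L / lam := by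
  -- the maximum of ‖Y‖ on the compact interval
  have hYc : Continuous (Y j) := hYj.continuous
  obtain ⟨m, hm, hmax⟩ := (isCompact_Icc (a := τ₀) (b := T)).exists_isMaxOn (nonempty_Icc.2 hT) (hYc.norm.continuousOn)
  have hL0 : 0 ≤ L := by obtain ⟨D, -, hDL⟩ := hD τ₀ ⟨le_rfl, hT⟩; exact (norm_nonneg D).trans hDL
  -- transport on [τ₀, m] with G = L + (λ/2)‖Y m‖
  have hG : ∀ s ∈ Icc τ₀ m, ‖((7/4:ℝ) * s) • deriv (Y j) s + lam • Y j s‖ ≤ L + lam / 2 * ‖Y j m‖ := by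
    intro s hs
    have hs' : s ∈ Icc τ₀ T := ⟨hs.1, hs.2.trans hm.2⟩
    obtain ⟨D, hDs, hDL⟩ := hD s hs'
    have h1 := far_transport_ineq hM hρΓ hℓ j hxj hunit ht hYj hperp s (htilt s) (hfar s hs') hDs
    have h2 : (7/2:ℝ) * (|s| * ‖iteratedDeriv 2 (x j) s‖) * ‖Y j s‖ ≤ lam / 2 * ‖Y j m‖ := by
      have := hκ s hs'
      have hYm : ‖Y j s‖ ≤ ‖Y j m‖ := hmax hs'
      calc (7/2:ℝ) * (|s| * ‖iteratedDeriv 2 (x j) s‖) * ‖Y j s‖ ≤ (7/2:ℝ) * (lam / 7) * ‖Y j m‖ := by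
            gcongr
        _ = lam / 2 * ‖Y j m‖ := by ring
    linarith
  have htr := norm_le_of_axial_transport hYj hτ₀ hm.1 (by norm_num : (0:ℝ) < 7/4) hlam hG
  have hpow : (τ₀ / m) ^ (lam / (7/4:ℝ)) ≤ 1 :=
    Real.rpow_le_one (div_nonneg hτ₀.le (by linarith [hm.1])) ((div_le_one (by linarith [hm.1])).2 hm.1) (by positivity)
  have hYm : ‖Y j m‖ ≤ 2 * ‖Y j τ₀‖ + 2 * L / lam := by
    have h1 : (τ₀ / m) ^ (lam / (7/4:ℝ)) * ‖Y j τ₀‖ ≤ ‖Y j τ₀‖ := mul_le_of_le_one_left (norm_nonneg _) hpow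
    have h2 : (L + lam / 2 * ‖Y j m‖) / lam = L / lam + ‖Y j m‖ / 2 := by field_simp
    rw [h2] at htr
    have h3 : L / lam ≥ 0 := by positivity
    have : 2 * L / lam = 2 * (L / lam) := by ring
    linarith
  intro τ hτ
  exact (hmax hτ).trans hYm

/-- **Far pinning, backward arm** (mirror of `far_pinning_pos` on `[T, τ₀]`, `τ₀ < 0`, by the time reversal `r ↦ Y_j(−r)`). [folklore] -/
theorem far_pinning_neg (hM : SlicedModel Γ ρ lam t x M) (hlam : 0 < lam) (hρΓ : 0 < ρ * Real.sqrt Γ)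
    (hℓ : Rb * Real.sqrt (Γ * Real.log Γ) ≠ 0) (j : Fin N) (hxj : ContDiff ℝ 2 (x j)) (hunit : ∀ s, ‖deriv (x j) s‖ = 1) (ht : ‖t j‖ = 1)
    (htilt : ∀ s, ‖deriv (x j) s - t j‖ ≤ 1 / 2) (hYj : ContDiff ℝ 1 (Y j)) (hperp : ∀ s, ⟪Y j s, deriv (x j) s⟫_ℝ = 0)
    {τ₀ T L : ℝ} (hτ₀ : τ₀ < 0) (hT : T ≤ τ₀)
    (hfar : ∀ s ∈ Icc T τ₀, 2 * (Rb * Real.sqrt (Γ * Real.log Γ)) ^ 2 < ‖x j s‖ ^ 2)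
    (hκ : ∀ s ∈ Icc T τ₀, |s| * ‖iteratedDeriv 2 (x j) s‖ ≤ lam / 7)
    (hD : ∀ s ∈ Icc T τ₀, ∃ D : EuclideanSpace ℝ (Fin 3),
      HasDerivAt (fun r : ℝ => swDefect Γ Rb γ α M (fun k σ => x k σ + r • Y k σ) j s) D 0 ∧ ‖D‖ ≤ L) :
    ∀ τ ∈ Icc T τ₀, ‖Y j τ‖ ≤ 2 * ‖Y j τ₀‖ + 2 * L / lam := by
  have hYc : Continuous (Y j) := hYj.continuous
  obtain ⟨m, hm, hmax⟩ := (isCompact_Icc (a := T) (b := τ₀)).exists_isMaxOn (nonempty_Icc.2 hT) (hYc.norm.continuousOn)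
  have hL0 : 0 ≤ L := by obtain ⟨D, -, hDL⟩ := hD τ₀ ⟨hT, le_rfl⟩; exact (norm_nonneg D).trans hDL
  -- reversed variation ỹ r = Y_j (−r) on [−τ₀, −m]
  set yt : ℝ → EuclideanSpace ℝ (Fin 3) := fun r => Y j (-r) with hyt
  have hytC : ContDiff ℝ 1 yt := hYj.comp contDiff_neg
  have hytd : ∀ r, deriv yt r = -deriv (Y j) (-r) := fun r => by
    rw [hyt]; exact deriv_comp_neg (Y j) r
  have hG : ∀ r ∈ Icc (-τ₀) (-m), ‖((7/4:ℝ) * r) • deriv yt r + lam • yt r‖ ≤ L + lam / 2 * ‖Y j m‖ := by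
    intro r hr
    have hs' : -r ∈ Icc T τ₀ := ⟨by linarith [hr.2, hm.1], by linarith [hr.1]⟩
    obtain ⟨D, hDs, hDL⟩ := hD (-r) hs'
    have h1 := far_transport_ineq hM hρΓ hℓ j hxj hunit ht hYj hperp (-r) (htilt (-r)) (hfar (-r) hs') hDs
    have h2 : (7/2:ℝ) * (|-r| * ‖iteratedDeriv 2 (x j) (-r)‖) * ‖Y j (-r)‖ ≤ lam / 2 * ‖Y j m‖ := by
      have := hκ (-r) hs'
      have hYm : ‖Y j (-r)‖ ≤ ‖Y j m‖ := hmax hs'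
      calc (7/2:ℝ) * (|-r| * ‖iteratedDeriv 2 (x j) (-r)‖) * ‖Y j (-r)‖ ≤ (7/2:ℝ) * (lam / 7) * ‖Y j m‖ := by
            gcongr
        _ = lam / 2 * ‖Y j m‖ := by ring
    have h3 : ((7/4:ℝ) * r) • deriv yt r + lam • yt r = ((7/4:ℝ) * (-r)) • deriv (Y j) (-r) + lam • Y j (-r) := by
      rw [hytd r, hyt, smul_neg, ← neg_smul]; ring_nf
    rw [h3]
    linarith
  have htr := norm_le_of_axial_transport hytC (by linarith : 0 < -τ₀) (by linarith [hm.2] : -τ₀ ≤ -m)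
    (by norm_num : (0:ℝ) < 7/4) hlam hG
  have hpow : (-τ₀ / -m) ^ (lam / (7/4:ℝ)) ≤ 1 :=
    Real.rpow_le_one (div_nonneg (by linarith) (by linarith [hm.2]))
      ((div_le_one (by linarith [hm.2])).2 (by linarith [hm.2])) (by positivity)
  have hyt0 : yt (-τ₀) = Y j τ₀ := by simp [hyt]
  have hytm : yt (-m) = Y j m := by simp [hyt]
  rw [hyt0, hytm] at htr
  have hYm : ‖Y j m‖ ≤ 2 * ‖Y j τ₀‖ + 2 * L / lam := by
    have h1 : (-τ₀ / -m) ^ (lam / (7/4:ℝ)) * ‖Y j τ₀‖ ≤ ‖Y j τ₀‖ := mul_le_of_le_one_left (norm_nonneg _) hpow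
    have h2 : (L + lam / 2 * ‖Y j m‖) / lam = L / lam + ‖Y j m‖ / 2 := by field_simp
    rw [h2] at htr
    have h3 : L / lam ≥ 0 := by positivity
    have : 2 * L / lam = 2 * (L / lam) := by ring
    linarith
  intro τ hτ
  exact (hmax hτ).trans hYm

end Summit.NavierStokesRegularity.NavierStokesRegularity.Theorems.SkeletonJ1RFrame
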